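import Summits.Ventures.PercRepro.TriangleCapEightF

/-!
# PercRepro — the triangle cap at nullity `8`: `P(8) = 13`, PART G — the case analysis (p3, gen 22)

`false_of_fourteen`: a coloop-free matroid with (C1)–(C3), nullity `8`, fourteen triangles, every degree `≥ 3`,
`|E| = r + 8 ≤ 14` with `r ≥ 5`, and a point `x` of degree `3` whose cone `X` (the union of its three lines:
seven points, rank `4`, every triangle inside it through `x`) is given, does not exist. With `H = cl X`,
`h = |H| ∈ [7, 10]`, `Y = E ∖ H`, `y = |Y|` and the bookkeeping `i / a / b` of part D:

* `h = 7`: `H = X`, so `i = 3`; then `a ≥ 12` (`Σ_H t ≥ 21`) against `a + b = 11`, or (`r = 6`) `2a + 3b = 21`;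
* `r = 5`, `h = 8` (`y = 5`): `b = 0`, `a ≥ 9`, at most one uncovered pair — partners are unique, so `a ≤ 7`;
* `r = 5`, `h ∈ {9, 10}`: the pair count `3b + a ≤ C(y, 2)` against `a + b ≥ 14 − cq (h − 4)` or `3y ≤ 3b + 2a`;
* `r = 6`, `h ∈ {8, 9, 10}` (`y ≤ 6`): every degree is exactly `3`, `b ≤ 1`, and the closure spread puts `Y` in
  `cl (insert y₀ H)` of rank `≤ 5` — against the rank `6`.

Axioms: standard.
-/

open scoped Matroid

namespace PercRepro

namespace TriangleCap

open Set Finset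

open scoped Classical

variable {α : Type}

/-- `cq 3 = 4`. -/
theorem cq_three : S1.cq 3 = 4 := by decide
/-- `cq 4 = 5`. -/
theorem cq_four : S1.cq 4 = 5 := by decide
/-- `cq 5 = 7`. -/
theorem cq_five : S1.cq 5 = 7 := by decide
/-- `cq 6 = 10`. -/
theorem cq_six : S1.cq 6 = 10 := by decide

/-- Degrees `≥ 3` summing to `3 |V|` are all `3`. -/
theorem degree_eq_three_of_sum (M : Matroid α) {V : Set α} (hV : V.Finite)
    (hdeg : ∀ v ∈ V, 3 ≤ (ThmN.trianglesThrough M v).ncard)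
    (hsum : ∑ v ∈ hV.toFinset, (ThmN.trianglesThrough M v).ncard ≤ 3 * V.ncard) :
    ∀ v ∈ V, (ThmN.trianglesThrough M v).ncard = 3 := by
  by_contra hcon
  have hex : ∃ v ∈ hV.toFinset, 3 < (ThmN.trianglesThrough M v).ncard := by
    by_contra hne
    apply hcon
    intro v hv
    have h1 := hdeg v hv
    have h2 : ¬ 3 < (ThmN.trianglesThrough M v).ncard := fun h => hne ⟨v, (Set.Finite.mem_toFinset hV).2 hv, h⟩
    omega
  have hlt := Finset.sum_lt_sum (s := hV.toFinset) (f := fun _ => 3)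
    (g := fun v => (ThmN.trianglesThrough M v).ncard)
    (fun v hv => hdeg v ((Set.Finite.mem_toFinset hV).1 hv)) hex
  rw [Finset.sum_const, smul_eq_mul, ← Set.ncard_eq_toFinset_card V hV] at hlt
  omega

/-- `Σ_{v ∈ V} t(v) ≥ 3 |V|` when every degree is `≥ 3`. -/
theorem three_mul_ncard_le_sum (M : Matroid α) {V : Set α} (hV : V.Finite)
    (hdeg : ∀ v ∈ V, 3 ≤ (ThmN.trianglesThrough M v).ncard) :
    3 * V.ncard ≤ ∑ v ∈ hV.toFinset, (ThmN.trianglesThrough M v).ncard := by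
  have := Finset.sum_le_sum (s := hV.toFinset) (f := fun _ => 3)
    (g := fun v => (ThmN.trianglesThrough M v).ncard) (fun v hv => hdeg v ((Set.Finite.mem_toFinset hV).1 hv))
  rw [Finset.sum_const, smul_eq_mul, ← Set.ncard_eq_toFinset_card V hV] at this
  linarith

/-- **A point of `Y` on no triangle avoiding `H`** exists when at most one triangle avoids `H` and `|Y| ≥ 4`. -/
theorem exists_no_type_b (M : Matroid α) [M.Finite] (𝒯 : Finset (Set α))
    (h𝒯 : ∀ T, T ∈ 𝒯 ↔ T ∈ ThmN.triangles M) {H : Set α}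
    (hb : (𝒯.filter (fun T => (T ∩ H).ncard = 0)).card ≤ 1) (hY4 : 4 ≤ (M.E \ H).ncard) :
    ∃ y₀ ∈ M.E \ H, ∀ T ∈ ThmN.trianglesThrough M y₀, (T ∩ H).ncard ≠ 0 := by
  have hYfin : (M.E \ H).Finite := M.ground_finite.subset Set.sdiff_subset
  by_contra hcon
  have hall : ∀ y ∈ (M.E \ H), ∃ T ∈ ThmN.trianglesThrough M y, (T ∩ H).ncard = 0 := by
    intro y hy
    by_contra h
    exact hcon ⟨y, hy, fun T hT h0 => h ⟨T, hT, h0⟩⟩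
  -- the double count over the type-b triangles
  have hdc := sum_ncard_inter_eq_sum_card_filter (𝒯.filter (fun T => (T ∩ H).ncard = 0)) hYfin
  have hlhs : ∑ T ∈ 𝒯.filter (fun T => (T ∩ H).ncard = 0), (T ∩ (M.E \ H)).ncard ≤ 3 := by
    calc ∑ T ∈ 𝒯.filter (fun T => (T ∩ H).ncard = 0), (T ∩ (M.E \ H)).ncard
        ≤ ∑ _T ∈ 𝒯.filter (fun T => (T ∩ H).ncard = 0), 3 := by
          apply Finset.sum_le_sum
          intro T hT
          have hT' : T ∈ ThmN.triangles M := (h𝒯 T).1 (Finset.mem_filter.1 hT).1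
          have := ncard_inter_add M (H := H) hT'
          omega
      _ = (𝒯.filter (fun T => (T ∩ H).ncard = 0)).card * 3 := by rw [Finset.sum_const, smul_eq_mul]
      _ ≤ 3 := by omega
  have hrhs : (M.E \ H).ncard ≤
      ∑ v ∈ hYfin.toFinset, ((𝒯.filter (fun T => (T ∩ H).ncard = 0)).filter (fun T => v ∈ T)).card := by
    calc (M.E \ H).ncard = ∑ _v ∈ hYfin.toFinset, 1 := by
          rw [Finset.sum_const, smul_eq_mul, mul_one, Set.ncard_eq_toFinset_card _ hYfin]
      _ ≤ _ := by
          apply Finset.sum_le_sum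
          intro v hv
          obtain ⟨T, hT, h0⟩ := hall v ((Set.Finite.mem_toFinset hYfin).1 hv)
          rw [Nat.one_le_iff_ne_zero, ← Nat.pos_iff_ne_zero, Finset.card_pos]
          exact ⟨T, by
            rw [Finset.mem_filter, Finset.mem_filter]
            exact ⟨⟨(h𝒯 T).2 ⟨hT.1, hT.2.1⟩, h0⟩, hT.2.2⟩⟩
  omega

/-- **The core contradiction.** -/
theorem false_of_fourteen (M : Matroid α) [M.Finite]
    (hC1 : ∀ L ⊆ M.E, M.eRk L = 2 → L.ncard ≤ 3) (hC2 : ∀ P ⊆ M.E, M.eRk P ≤ 3 → P.ncard ≤ 6)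
    (hC3 : ∀ X ⊆ M.E, M.eRk X ≤ 4 → X.ncard ≤ 10)
    (hs14 : (ThmN.triangles M).ncard = 14) (hdeg : ∀ y ∈ M.E, 3 ≤ (ThmN.trianglesThrough M y).ncard)
    {r : ℕ} (hr : M.eRank = (r : ℕ∞)) (hnr : M.E.ncard = r + 8) (hr5 : 5 ≤ r) (hm14 : M.E.ncard ≤ 14)
    {X : Set α} (hXE : X ⊆ M.E) (hXn : X.ncard = 7) (hXr : M.eRk X = 4)
    {x : α} (hxX : x ∈ X) (hx3 : (ThmN.trianglesThrough M x).ncard = 3)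
    (hxT : ∀ T ∈ ThmN.trianglesThrough M x, T ⊆ X)
    (hcone : ∀ T ∈ ThmN.triangles M, T ⊆ X → x ∈ T) : False := by
  -- the closure `H` of the cone and `Y = E ∖ H`
  have hHE : M.closure X ⊆ M.E := M.closure_subset_ground X
  have hXH : X ⊆ M.closure X := M.subset_closure X hXE
  have hHfin : (M.closure X).Finite := M.ground_finite.subset hHE
  have hYfin : (M.E \ M.closure X).Finite := M.ground_finite.subset Set.sdiff_subset
  have hHr : M.eRk (M.closure X) = 4 := by rw [M.eRk_closure_eq, hXr]
  have hH10 : (M.closure X).ncard ≤ 10 := hC3 _ hHE (by rw [hHr])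
  have hH7 : 7 ≤ (M.closure X).ncard := by rw [← hXn]; exact Set.ncard_le_ncard hXH hHfin
  have hF1 : ∀ T ∈ ThmN.triangles M, ∀ a ∈ T, ∀ b ∈ T, a ≠ b → a ∈ M.closure X → b ∈ M.closure X →
      T ⊆ M.closure X := fun T hT a ha b hb hab haH hbH =>
    triangle_subset_closure_of_two_mem M hT ha hb hab haH hbH
  have hSfin : (ThmN.triangles M).Finite :=
    M.ground_finite.finite_subsets.subset (fun C hC => hC.1.subset_ground)
  obtain ⟨𝒯, h𝒯⟩ : ∃ 𝒯 : Finset (Set α), ∀ T, T ∈ 𝒯 ↔ T ∈ ThmN.triangles M :=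
    ⟨hSfin.toFinset, fun T => Set.Finite.mem_toFinset hSfin⟩
  have h𝒯14 : 𝒯.card = 14 := by rw [← ncard_triangles_eq_card M 𝒯 h𝒯, hs14]
  obtain ⟨hcard, hsumH, hsumY, hchoose, hpairs, hi⟩ := bookkeeping M hC1 𝒯 h𝒯 hHE hF1
  -- the inside count against p2's table
  have hi_le : (𝒯.filter (fun T => (T ∩ M.closure X).ncard = 3)).card ≤
      S1.cq ((M.closure X).ncard - 4) := by
    rw [hi]
    exact ncard_triangles_subset_le_cq M hC1 hC2 hC3 hHE (r := 4) (d := (M.closure X).ncard - 4) hHr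
      (by omega)
  -- the degree sums from below
  have hdegH := three_mul_ncard_le_sum M (M.ground_finite.subset hHE) (fun v hv => hdeg v (hHE hv))
  have hdegY := three_mul_ncard_le_sum M
    (M.ground_finite.subset Set.sdiff_subset : (M.E \ M.closure X).Finite) (fun v hv => hdeg v hv.1)
  have hYn : (M.E \ M.closure X).ncard = M.E.ncard - (M.closure X).ncard :=
    Set.ncard_sdiff' hHE M.ground_finite
  -- every triangle through `x` lies in `H`
  have hx_in : ∀ T ∈ 𝒯, x ∈ T → (T ∩ M.closure X).ncard = 3 := by
    intro T hT hxT'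
    have hT' : T ∈ ThmN.triangles M := (h𝒯 T).1 hT
    have hsub : T ⊆ M.closure X := (hxT T ⟨hT'.1, hT'.2, hxT'⟩).trans hXH
    rw [Set.inter_eq_left.2 hsub, hT'.2]
  -- `h = 7` forces `i = 3`
  have hi3 : (M.closure X).ncard = 7 → (𝒯.filter (fun T => (T ∩ M.closure X).ncard = 3)).card = 3 := by
    intro h7
    have hHX : M.closure X = X := (Set.eq_of_subset_of_ncard_le hXH (by omega) hHfin).symm
    rw [hi, ← hx3]
    congr 1
    ext T
    simp only [Set.mem_setOf_eq, ThmN.trianglesThrough, ThmN.triangles]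
    constructor
    · intro hT
      exact ⟨hT.1.1, hT.1.2, hcone T hT.1 (hT.2.trans hHX.subset)⟩
    · intro hT
      exact ⟨⟨hT.1, hT.2.1⟩, (hxT T hT).trans hXH⟩
  -- the numbers
  obtain ⟨i, hi_def⟩ : ∃ i, (𝒯.filter (fun T => (T ∩ M.closure X).ncard = 3)).card = i := ⟨_, rfl⟩
  obtain ⟨a, ha_def⟩ : ∃ a, (𝒯.filter (fun T => (T ∩ M.closure X).ncard = 1)).card = a := ⟨_, rfl⟩
  obtain ⟨b, hb_def⟩ : ∃ b, (𝒯.filter (fun T => (T ∩ M.closure X).ncard = 0)).card = b := ⟨_, rfl⟩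
  obtain ⟨h, hh_def⟩ : ∃ h, (M.closure X).ncard = h := ⟨_, rfl⟩
  obtain ⟨y, hy_def⟩ : ∃ y, (M.E \ M.closure X).ncard = y := ⟨_, rfl⟩
  rw [hi_def, ha_def, hb_def] at hcard
  rw [ha_def, hi_def] at hsumH
  rw [hb_def, ha_def] at hsumY hchoose hpairs
  rw [hi_def] at hi_le hi3
  rw [hsumH] at hdegH
  rw [hsumY] at hdegY
  rw [hh_def] at hdegH hH10 hH7 hYn hi_le hi3
  rw [hy_def] at hdegY hYn hpairs
  rw [h𝒯14] at hcard
  -- the rank-`6` case: the closure spread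
  have hspread : r = 6 → y ≤ 6 → b ≤ 1 → False := by
    intro hr6 hY6 hb1
    have hY4 : 4 ≤ (M.E \ M.closure X).ncard := by omega
    have hdeg3 : ∀ z ∈ M.E \ M.closure X, (ThmN.trianglesThrough M z).ncard = 3 := by
      apply degree_eq_three_of_sum M
        (M.ground_finite.subset Set.sdiff_subset : (M.E \ M.closure X).Finite) (fun v hv => hdeg v hv.1)
      rw [hsumY, hy_def]
      omega
    have hb1' : (𝒯.filter (fun T => (T ∩ M.closure X).ncard = 0)).card ≤ 1 := by rw [hb_def]; exact hb1
    obtain ⟨y₀, hy₀, hy₀b⟩ := exists_no_type_b M 𝒯 h𝒯 hb1' hY4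
    have hYF := subset_closure_insert_of_spread M hC1 𝒯 h𝒯 hF1 hdeg3 hb1' hy₀ hy₀b (by rw [hy_def]; exact hY6)
    have hEF : M.E ⊆ M.closure (insert y₀ (M.closure X)) := by
      intro z hz
      by_cases hzH : z ∈ M.closure X
      · exact M.subset_closure (insert y₀ (M.closure X))
          (Set.insert_subset hy₀.1 hHE) (Set.mem_insert_of_mem _ hzH)
      · exact hYF ⟨hz, hzH⟩
    have hrk : M.eRank ≤ 5 := by
      calc M.eRank = M.eRk M.E := M.eRank_def
        _ ≤ M.eRk (M.closure (insert y₀ (M.closure X))) := M.eRk_mono hEF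
        _ = M.eRk (insert y₀ (M.closure X)) := M.eRk_closure_eq _
        _ ≤ M.eRk (M.closure X) + 1 := M.eRk_insert_le_add_one _ _
        _ = 5 := by rw [hHr]; norm_num
    rw [hr, hr6] at hrk
    norm_num at hrk
  -- the rank-`5`, `h = 8` case: partner injectivity
  have hinj : r = 5 → h = 8 → False := by
    intro hr5' h8
    have hy5 : y = 5 := by omega
    have hcq : S1.cq (h - 4) = 5 := by rw [h8]; exact cq_four
    have hc52 : Nat.choose 5 2 = 10 := by decide
    rw [hy5, hc52] at hpairs
    have hb0 : b = 0 := by omega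
    have ha9 : 9 ≤ a := by omega
    have hb0' : ∀ T ∈ 𝒯, (T ∩ M.closure X).ncard ≠ 0 := by
      have : (𝒯.filter (fun T => (T ∩ M.closure X).ncard = 0)).card = 0 := by rw [hb_def, hb0]
      rw [Finset.card_eq_zero, Finset.filter_eq_empty_iff] at this
      exact this
    have hpair : ∀ T ∈ 𝒯, ∀ T' ∈ 𝒯, T ≠ T' → ∀ p q, p ≠ q → p ∈ T → p ∈ T' → q ∈ T → q ∈ T' → False :=
      fun T hT T' hT' hne p q hpq hp hp' hq hq' =>
        S1.two_triangles_share_pair M hC1 ((h𝒯 T).1 hT) ((h𝒯 T').1 hT') hne hp hp' hq hq' hpq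
    have hbig : Nat.choose (M.E \ M.closure X).ncard 2 <
        ∑ T ∈ 𝒯, Nat.choose (T ∩ (M.E \ M.closure X)).ncard 2 + 2 := by
      rw [hchoose, hy_def, hy5, hc52]; omega
    have hcov : ∀ p₁ ∈ M.E \ M.closure X, ∀ q₁ ∈ M.E \ M.closure X, ∀ p₂ ∈ M.E \ M.closure X,
        ∀ q₂ ∈ M.E \ M.closure X, p₁ ≠ q₁ → p₂ ≠ q₂ → ({p₁, q₁} : Set α) ≠ {p₂, q₂} →
        (∃ T ∈ 𝒯, p₁ ∈ T ∧ q₁ ∈ T) ∨ (∃ T ∈ 𝒯, p₂ ∈ T ∧ q₂ ∈ T) :=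
      fun p₁ hp₁ q₁ hq₁ p₂ hp₂ q₂ hq₂ h1 h2 hne =>
        exists_cover_of_card 𝒯 hYfin hpair hbig hp₁ hq₁ hp₂ hq₂ h1 h2 hne
    have huniq : ∀ u ∈ M.closure X, ∀ T ∈ 𝒯, ∀ T' ∈ 𝒯, T ≠ T' → (T ∩ M.closure X).ncard = 1 →
        (T' ∩ M.closure X).ncard = 1 → u ∈ T → u ∈ T' → False :=
      fun u huH T hT T' hT' hne h1 h1' huT huT' =>
        partner_unique M hC1 hC2 𝒯 h𝒯 hF1 hb0' hcov hT hT' hne h1 h1' huT huT' huH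
    have hxA : ∀ T ∈ 𝒯, (T ∩ M.closure X).ncard = 1 → x ∉ T := by
      intro T hT h1 hxT'
      have := hx_in T hT hxT'
      omega
    have := card_type_a_le M 𝒯 hHfin (hXH hxX) hxA huniq
    rw [ha_def, hh_def, h8] at this
    omega
  -- the case analysis on `h = |H|` and `r`
  have hr56 : r = 5 ∨ r = 6 := by omega
  have hh : h = 7 ∨ h = 8 ∨ h = 9 ∨ h = 10 := by omega
  rcases hh with h7 | h8 | h9 | h10
  · -- `h = 7`
    have hi3' := hi3 h7
    rcases hr56 with hr5' | hr6
    · omega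
    · omega
  · -- `h = 8`
    have hcq : S1.cq (h - 4) = 5 := by rw [h8]; exact cq_four
    rcases hr56 with hr5' | hr6
    · exact hinj hr5' h8
    · have hy6 : y = 6 := by omega
      have hc : Nat.choose 6 2 = 15 := by decide
      rw [hy6, hc] at hpairs
      exact hspread hr6 (by omega) (by omega)
  · -- `h = 9`
    have hcq : S1.cq (h - 4) = 7 := by rw [h9]; exact cq_five
    rcases hr56 with hr5' | hr6
    · have hy4 : y = 4 := by omega
      have hc : Nat.choose 4 2 = 6 := by decide
      rw [hy4, hc] at hpairs
      omega
    · have hy5 : y = 5 := by omega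
      have hc : Nat.choose 5 2 = 10 := by decide
      rw [hy5, hc] at hpairs
      exact hspread hr6 (by omega) (by omega)
  · -- `h = 10`
    have hcq : S1.cq (h - 4) = 10 := by rw [h10]; exact cq_six
    rcases hr56 with hr5' | hr6
    · have hy3 : y = 3 := by omega
      have hc : Nat.choose 3 2 = 3 := by decide
      rw [hy3, hc] at hpairs
      omega
    · have hy4 : y = 4 := by omega
      have hc : Nat.choose 4 2 = 6 := by decide
      rw [hy4, hc] at hpairs
      exact hspread hr6 (by omega) (by omega)

end TriangleCap

end PercRepro
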